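import Summits.AtomisticToContinuum.HydrodynamicLimit.Theses.InformationPercolationEngine
import Summits.AtomisticToContinuum.HydrodynamicLimit.Theorems.JParityClosureEvenStressEnskogKineticEnergyTight
import Summits.AtomisticToContinuum.HydrodynamicLimit.Theorems.JParityClosureDensityCapMeanDisplacement
import Literature.MathematicalPhysics.KineticTheory.CollisionTubeWeightOscillation
import Literature.MathematicalPhysics.KineticTheory.CollisionTubePullbackPacking
import Literature.MathematicalPhysics.KineticTheory.HardSphereCanonicalTorus
import Literature.Analysis.FluidPDE.HardSphereCollisionRecord
import HarnessLib

/-!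
# T2a · the continuity correction under the EVOLVED local Gibbs law, from the short-flight deficit
# (`stub_continuityCorrectionLG`, line `Sketch` v17, crux `InformationPercolationEngine.CollisionRate`,
# stmt-AtomisticToContinuum-13481)

Registered stub T2a: `CollisionMomentBound → ShortFlightDeficitLG → ContinuityCorrectionLG` for GENERAL continuous
positive profiles (the local Gibbs law is NOT invariant under the flow).  It is the general-profile twin of the
rung-0 Literature reduction `localGibbsLaw_continuityCorrection_rung0_of_shortFlightDeficit`
(`CollisionTubePullbackRung0Reduction`), whose only use of stationarity was the collision-flux bound for the
oscillation mark `b_N`; here that bound is REPLACED by the route's tail support `CollisionMomentBound`.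

* Pathwise (`continuityCorrection_le`, `CollisionTubeWeightOscillation`): on a good orbit with kinetic energy per
  particle `≤ E₀` and the mean-displacement inequality (`Theorems.stub_meanDisplacement`, pathwise, any flow),
  `R_cont ≤ κε · Σ_{coll ≤ τ} b_N(vᵢ, vⱼ) + 2C_χC_g · R_short`, with the velocity mark
  `b_N = C_Ψ (C_g u₁ + C_χ u₂)`, `u₁ = ϵ₁` if `κε(1 + ‖v‖ + ‖w‖) ≤ Δ₁` else `2C_χ`, `u₂ = ϵ₂` if
  `σ³(3/πr⁴) κε(√(2E₀) + ‖v‖ + ‖w‖) ≤ Δ₂` else `2C_g` (moduli of continuity `Δ₁, Δ₂` of `χ`, `g`).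
* The indicator of a fast pair is at most a quadratic: `𝟙{A > Δ} ≤ (A/Δ)²` and `(a + b + c)² ≤ 3(a² + b² + c²)`,
  so `b_N(v, w) ≤ (C_Ψ(C_gϵ₁ + C_χϵ₂) + (κε_N)² D) · (1 + ‖v‖² + ‖w‖²)` (`exists_oscMark_le_quadratic`), and
  `ε/(N+1) Σ_coll b_N ≤ (C_Ψ(C_gϵ₁ + C_χϵ₂) + (κε_N)² D) · K_N[1 + ‖vᵢ‖² + ‖vⱼ‖²] ≤ η/2` on the event
  `{K_N[1 + ‖vᵢ‖² + ‖vⱼ‖²] ≤ K_b}` of `CollisionMomentBound` once `ϵ₁, ϵ₂` are chosen after `K_b, L` and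
  `N` is large (`ε_N → 0`, `tendsto_hsDiameter`).
* The short-flight term is the antecedent T2b at accuracy `η/(2(2C_χC_g + 1))`, same `Ψ, L, κ`.
* Union bound over the null bad set (`localGibbsLaw_goodCompl`), the kinetic-energy event
  (`Theorems.EvenStressEnskog.stub_kineticEnergyTight`, read at `t = 0`), the `CollisionMomentBound` event and the
  T2b event, each at `δ/3`.

References: C. Cercignani, R. Illner, M. Pulvirenti, *The Mathematical Theory of Dilute Gases* (1994), §2.2,
App. 4.A; I. Gallagher, L. Saint-Raymond, B. Texier, *From Newton to Boltzmann* (2013), Part II Ch. 4, §4.1.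
-/

noncomputable section

open MeasureTheory Set Filter Topology
open scoped ENNReal InnerProductSpace BigOperators

namespace Summit.AtomisticToContinuum.HydrodynamicLimit.Theorems.CollisionRate

open Literature.Analysis.FluidPDE Literature.MathematicalPhysics.KineticTheory
open Summit.AtomisticToContinuum.HydrodynamicLimit.Theses.InformationPercolationEngine (CollisionMomentBound)
open Summit.AtomisticToContinuum.HydrodynamicLimit.Theorems.EvenStressEnskog (stub_kineticEnergyTight)

/-! ## The fast-pair indicators are at most quadratic -/

/-- `(if A ≤ Δ then e else c) ≤ e + c (A/Δ)²` for `e, c ≥ 0`, `Δ > 0`: off `{A ≤ Δ}` one has `(A/Δ)² ≥ 1`.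
[folklore] -/
theorem ite_le_add_mul_sq {A Δ e c : ℝ} (he : 0 ≤ e) (hc : 0 ≤ c) (hΔ : 0 < Δ) :
    (if A ≤ Δ then e else c) ≤ e + c * (A / Δ) ^ 2 := by
  split_ifs with h
  · exact le_add_of_nonneg_right (by positivity)
  · have h1 : 1 ≤ A / Δ := by rw [le_div_iff₀ hΔ, one_mul]; exact (not_le.1 h).le
    calc c = c * 1 := (mul_one c).symm
      _ ≤ c * (A / Δ) ^ 2 := mul_le_mul_of_nonneg_left (by nlinarith) hc
      _ ≤ e + c * (A / Δ) ^ 2 := le_add_of_nonneg_left he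

/-- **The oscillation mark is dominated by the second-moment mark.**  For `C_Ψ, C_g, C_χ, ϵ₁, ϵ₂ ≥ 0` and
`Δ₁, Δ₂ > 0` there is `D ≥ 0` with, for all real `t, x, y` (read `t = κε_N`, `x = ‖v‖`, `y = ‖w‖`),
`C_Ψ (C_g u₁ + C_χ u₂) ≤ (C_Ψ(C_gϵ₁ + C_χϵ₂) + t² D)(1 + x² + y²)` where `u₁ = ϵ₁` if `t(1 + x + y) ≤ Δ₁` else
`2C_χ` and `u₂ = ϵ₂` if `c_r t (R + x + y) ≤ Δ₂` else `2C_g` (`𝟙{A > Δ} ≤ (A/Δ)²`, `(a + b + c)² ≤ 3(a² + b² + c²)`;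
explicitly `D = 6 C_Ψ C_g C_χ (1/Δ₁² + c_r²(R² + 1)/Δ₂²)`). [folklore] -/
theorem exists_oscMark_le_quadratic {CΨ Cg Cχ ϵ₁ ϵ₂ Δ₁ Δ₂ : ℝ} (hCΨ : 0 ≤ CΨ) (hCg : 0 ≤ Cg)
    (hCχ : 0 ≤ Cχ) (hϵ₁ : 0 ≤ ϵ₁) (hϵ₂ : 0 ≤ ϵ₂) (hΔ₁ : 0 < Δ₁) (hΔ₂ : 0 < Δ₂) (cr R : ℝ) :
    ∃ D : ℝ, 0 ≤ D ∧ ∀ t x y : ℝ,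
      CΨ * (Cg * (if t * (1 + (x + y)) ≤ Δ₁ then ϵ₁ else 2 * Cχ) +
          Cχ * (if cr * (t * (R + (x + y))) ≤ Δ₂ then ϵ₂ else 2 * Cg)) ≤
        (CΨ * (Cg * ϵ₁ + Cχ * ϵ₂) + t ^ 2 * D) * (1 + x ^ 2 + y ^ 2) := by
  refine ⟨6 * CΨ * Cg * Cχ * (1 / Δ₁ ^ 2 + cr ^ 2 * (R ^ 2 + 1) / Δ₂ ^ 2), by positivity, fun t x y => ?_⟩
  have hQ : 1 ≤ 1 + x ^ 2 + y ^ 2 := by nlinarith [sq_nonneg x, sq_nonneg y]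
  have h1 := ite_le_add_mul_sq (A := t * (1 + (x + y))) hϵ₁ (by positivity : (0 : ℝ) ≤ 2 * Cχ) hΔ₁
  have h2 := ite_le_add_mul_sq (A := cr * (t * (R + (x + y)))) hϵ₂ (by positivity : (0 : ℝ) ≤ 2 * Cg) hΔ₂
  have hu : (t * (1 + (x + y)) / Δ₁) ^ 2 ≤ t ^ 2 * (3 * (1 + x ^ 2 + y ^ 2)) / Δ₁ ^ 2 := by
    rw [div_pow, mul_pow]
    refine div_le_div_of_nonneg_right (mul_le_mul_of_nonneg_left ?_ (sq_nonneg t)) (sq_nonneg Δ₁)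
    nlinarith [sq_nonneg (1 - x), sq_nonneg (x - y), sq_nonneg (y - 1)]
  have hu' : (cr * (t * (R + (x + y))) / Δ₂) ^ 2 ≤
      cr ^ 2 * (t ^ 2 * (3 * (R ^ 2 + 1) * (1 + x ^ 2 + y ^ 2))) / Δ₂ ^ 2 := by
    rw [div_pow, mul_pow, mul_pow]
    refine div_le_div_of_nonneg_right (mul_le_mul_of_nonneg_left
      (mul_le_mul_of_nonneg_left ?_ (sq_nonneg t)) (sq_nonneg cr)) (sq_nonneg Δ₂)
    nlinarith [sq_nonneg (R - x), sq_nonneg (x - y), sq_nonneg (y - R), sq_nonneg (R * x), sq_nonneg (R * y)]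
  calc CΨ * (Cg * (if t * (1 + (x + y)) ≤ Δ₁ then ϵ₁ else 2 * Cχ) +
        Cχ * (if cr * (t * (R + (x + y))) ≤ Δ₂ then ϵ₂ else 2 * Cg))
      ≤ CΨ * (Cg * (ϵ₁ + 2 * Cχ * (t ^ 2 * (3 * (1 + x ^ 2 + y ^ 2)) / Δ₁ ^ 2)) +
          Cχ * (ϵ₂ + 2 * Cg * (cr ^ 2 * (t ^ 2 * (3 * (R ^ 2 + 1) * (1 + x ^ 2 + y ^ 2))) / Δ₂ ^ 2))) := by
        refine mul_le_mul_of_nonneg_left (add_le_add (mul_le_mul_of_nonneg_left (h1.trans ?_) hCg)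
          (mul_le_mul_of_nonneg_left (h2.trans ?_) hCχ)) hCΨ
        · exact add_le_add le_rfl (mul_le_mul_of_nonneg_left hu (by positivity))
        · exact add_le_add le_rfl (mul_le_mul_of_nonneg_left hu' (by positivity))
    _ = CΨ * (Cg * ϵ₁ + Cχ * ϵ₂) * 1 +
          t ^ 2 * (6 * CΨ * Cg * Cχ * (1 / Δ₁ ^ 2 + cr ^ 2 * (R ^ 2 + 1) / Δ₂ ^ 2)) * (1 + x ^ 2 + y ^ 2) := by
        ring
    _ ≤ CΨ * (Cg * ϵ₁ + Cχ * ϵ₂) * (1 + x ^ 2 + y ^ 2) +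
          t ^ 2 * (6 * CΨ * Cg * Cχ * (1 / Δ₁ ^ 2 + cr ^ 2 * (R ^ 2 + 1) / Δ₂ ^ 2)) * (1 + x ^ 2 + y ^ 2) :=
        add_le_add (mul_le_mul_of_nonneg_left hQ (by positivity)) le_rfl
    _ = _ := by ring

/-! ## The registered stub -/

/-- **T2a · the continuity correction under the EVOLVED local Gibbs law, from the short-flight deficit**
(registered stub `stub_continuityCorrectionLG` of line `Sketch`, skeleton v17, crux stmt-AtomisticToContinuum-13481,
verbatim: `CollisionMomentBound → ShortFlightDeficitLG → ContinuityCorrectionLG`).  `η₀ := 1`;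
`σ₀ := min σ_E (min σ_M σ_S)` (`stub_kineticEnergyTight`, `CollisionMomentBound`, the antecedent T2b, each at `δ/3`);
`r₀ := 1`; `κ₀ :=` the one of T2b at accuracy `η/(2(2C_χC_g + 1))`; the accuracies `ϵ₁, ϵ₂` of the moduli of
continuity are chosen after `K_b` and `L`; `N₀ := max` of the three thresholds and of the one making
`(κε_N)² D K_b ≤ η/4`.  Then the four-set inclusion of the module docstring, pathwise from
`continuityCorrection_le` with the quadratic majorant of `exists_oscMark_le_quadratic`. [folklore] -/
theorem stub_continuityCorrectionLG :
    CollisionMomentBound →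
    (∀ (a₀ θ₀ : T3 → ℝ) (u₀ : T3 → V3), Continuous a₀ → Continuous θ₀ → Continuous u₀ →
      (∀ x, 0 < a₀ x) → (∀ x, 0 < θ₀ x) → ∃ σ₀ : ℝ, 0 < σ₀ ∧ ∀ σ : ℝ, 0 < σ → σ < σ₀ →
      ∀ Φ : (N : ℕ) → HardSphereFlow (Torus.geometry (Fin 3)) (hsDiameter σ N) (N + 1),
      ∀ τ : ℝ, 0 < τ → ∀ η δ : ℝ, 0 < η → 0 < δ →
      ∀ L : ℝ, 1 ≤ L → ∃ κ₀ : ℝ, 0 < κ₀ ∧ ∀ κ : ℝ, 0 < κ → κ < κ₀ → ∃ N₀ : ℕ, ∀ N : ℕ, N₀ ≤ N →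
      ∀ Ψ : V3 × V3 × V3 → ℝ, (∀ q, |Ψ q| ≤ 2 * L) →
        localGibbsLaw σ a₀ u₀ θ₀ N (Φ N)
          {z | η < ((N + 1 : ℝ) * κ)⁻¹ * shortFlightDeficit σ N (Φ N) τ Ψ κ z} ≤ ENNReal.ofReal δ) →
    ∃ η₀ : ℝ, 0 < η₀ ∧ ∀ (a₀ θ₀ : T3 → ℝ) (u₀ : T3 → V3), Continuous a₀ → Continuous θ₀ → Continuous u₀ →
      (∀ x, 0 < a₀ x) → (∀ x, 0 < θ₀ x) → ∃ σ₀ : ℝ, 0 < σ₀ ∧ ∀ σ : ℝ, 0 < σ → σ < σ₀ →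
      ∀ Φ : (N : ℕ) → HardSphereFlow (Torus.geometry (Fin 3)) (hsDiameter σ N) (N + 1),
      ∀ τ : ℝ, 0 < τ → ∀ χ : ℝ × T3 → ℝ, Continuous χ → ∀ g : ℝ → ℝ, Continuous g →
      (∀ x, η₀ ≤ x → g x = 0) →
      ∀ η δ : ℝ, 0 < η → 0 < δ → ∃ r₀ : ℝ, 0 < r₀ ∧ ∀ r : ℝ, 0 < r → r < r₀ →
      ∀ L : ℝ, 1 ≤ L → ∃ κ₀ : ℝ, 0 < κ₀ ∧ ∀ κ : ℝ, 0 < κ → κ < κ₀ → ∃ N₀ : ℕ, ∀ N : ℕ, N₀ ≤ N →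
      ∀ Ψ : V3 × V3 × V3 → ℝ, (∀ q, |Ψ q| ≤ 2 * L) →
        localGibbsLaw σ a₀ u₀ θ₀ N (Φ N)
          {z | η < ((N + 1 : ℝ) * κ)⁻¹ * continuityCorrection σ N (Φ N) τ χ g Ψ r κ z} ≤ ENNReal.ofReal δ := by
  intro hCMB hSF
  refine ⟨1, one_pos, fun a₀ θ₀ u₀ ha hθ hu ha0 hθ0 => ?_⟩
  obtain ⟨σE, hσE, HE⟩ := stub_kineticEnergyTight a₀ θ₀ u₀ ha hθ hu ha0 hθ0
  obtain ⟨σM, hσM, HM⟩ := hCMB a₀ θ₀ u₀ ha hθ hu ha0 hθ0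
  obtain ⟨σS, hσS, HS⟩ := hSF a₀ θ₀ u₀ ha hθ hu ha0 hθ0
  refine ⟨min σE (min σM σS), lt_min hσE (lt_min hσM hσS), ?_⟩
  intro σ hσ hσlt Φ τ hτ χ hχ g hg hg0 η δ hη hδ
  have hσE' : σ < σE := hσlt.trans_le (min_le_left _ _)
  have hσM' : σ < σM := hσlt.trans_le ((min_le_right _ _).trans (min_le_left _ _))
  have hσS' : σ < σS := hσlt.trans_le ((min_le_right _ _).trans (min_le_right _ _))
  obtain ⟨Cχ, hCχ0, hχb⟩ := exists_abs_bound_chi hχ τ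
  obtain ⟨Cg, hCg0, hgb⟩ := exists_abs_bound_of_cutoff hg hg0
  set C₂ : ℝ := 2 * Cχ * Cg + 1 with hC₂
  have hC₂0 : 0 < C₂ := by rw [hC₂]; positivity
  obtain ⟨E₀, NK, hK⟩ := HE σ hσ hσE' Φ (δ / 3) (by positivity)
  obtain ⟨Kb, NM, hM⟩ := HM σ hσ hσM' Φ τ hτ (δ / 3) (by positivity)
  obtain ⟨Kb', hKbKb', hKb'0⟩ : ∃ Kb' : ℝ, Kb ≤ Kb' ∧ 0 < Kb' :=
    ⟨max Kb 1, le_max_left _ _, one_pos.trans_le (le_max_right _ _)⟩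
  have HS₁ := HS σ hσ hσS' Φ τ hτ (η / (2 * C₂)) (δ / 3) (by positivity) (by positivity)
  refine ⟨1, one_pos, fun r hr _ L hL => ?_⟩
  obtain ⟨κS, hκS, HS₂⟩ := HS₁ L hL
  refine ⟨κS, hκS, fun κ hκ hκlt => ?_⟩
  obtain ⟨NS, hNS⟩ := HS₂ κ hκ hκlt
  -- constants: `C_Ψ = 2L`, the accuracies `ϵ₁, ϵ₂` (after `K_b`, `L`), the moduli `Δ₁, Δ₂`, the constant `D`
  have hL0 : 0 < L := one_pos.trans_le hL
  have hCΨ0 : (0 : ℝ) ≤ 2 * L := by positivity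
  set ϵ₁ : ℝ := η / (8 * (2 * L) * (Cg + 1) * Kb') with hϵ₁
  set ϵ₂ : ℝ := η / (8 * (2 * L) * (Cχ + 1) * Kb') with hϵ₂
  have hϵ₁0 : 0 < ϵ₁ := by rw [hϵ₁]; positivity
  have hϵ₂0 : 0 < ϵ₂ := by rw [hϵ₂]; positivity
  have hblim : 2 * L * (Cg * ϵ₁ + Cχ * ϵ₂) * Kb' ≤ η / 4 := by
    have h1 : 2 * L * (Cg * ϵ₁) * Kb' ≤ η / 8 := by
      rw [hϵ₁, show 2 * L * (Cg * (η / (8 * (2 * L) * (Cg + 1) * Kb'))) * Kb' = η / 8 * (Cg / (Cg + 1)) by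
        field_simp]
      exact mul_le_of_le_one_right (by positivity) ((div_le_one (by positivity)).2 (by linarith))
    have h2 : 2 * L * (Cχ * ϵ₂) * Kb' ≤ η / 8 := by
      rw [hϵ₂, show 2 * L * (Cχ * (η / (8 * (2 * L) * (Cχ + 1) * Kb'))) * Kb' = η / 8 * (Cχ / (Cχ + 1)) by
        field_simp]
      exact mul_le_of_le_one_right (by positivity) ((div_le_one (by positivity)).2 (by linarith))
    nlinarith [h1, h2]
  obtain ⟨Δ₁, hΔ₁, hχuc⟩ : ∃ Δ₁ > 0, ∀ p ∈ Icc (0 : ℝ) τ ×ˢ (univ : Set T3), ∀ q ∈ Icc (0 : ℝ) τ ×ˢ (univ : Set T3),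
      dist p q ≤ Δ₁ → dist (χ p) (χ q) ≤ ϵ₁ :=
    Metric.uniformContinuousOn_iff_le.1
      (((isCompact_Icc (a := (0 : ℝ)) (b := τ)).prod (isCompact_univ (X := T3))).uniformContinuousOn_of_continuous
        hχ.continuousOn) ϵ₁ hϵ₁0
  obtain ⟨Δ₂, hΔ₂, hguc⟩ : ∃ Δ₂ > 0, ∀ x ∈ Icc (0 : ℝ) (σ ^ 3 * (3 / (Real.pi * r ^ 3))),
      ∀ y ∈ Icc (0 : ℝ) (σ ^ 3 * (3 / (Real.pi * r ^ 3))), dist x y ≤ Δ₂ → dist (g x) (g y) ≤ ϵ₂ :=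
    Metric.uniformContinuousOn_iff_le.1
      ((isCompact_Icc (a := (0 : ℝ)) (b := σ ^ 3 * (3 / (Real.pi * r ^ 3)))).uniformContinuousOn_of_continuous
        hg.continuousOn) ϵ₂ hϵ₂0
  obtain ⟨D, hD0, hmark⟩ := exists_oscMark_le_quadratic hCΨ0 hCg0 hCχ0 hϵ₁0.le hϵ₂0.le hΔ₁ hΔ₂
    (σ ^ 3 * (3 / (Real.pi * r ^ 4))) (Real.sqrt (2 * E₀))
  -- the threshold in `N` making the fast-pair term small: `(κ ε_N)² D K_b' < η/4`
  have hlim : Tendsto (fun n => (κ * hsDiameter σ n) ^ 2 * (D * Kb')) atTop (𝓝 0) := by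
    rw [show (0 : ℝ) = (κ * 0) ^ 2 * (D * Kb') by ring]
    exact (((tendsto_hsDiameter σ).const_mul κ).pow 2).mul_const (D * Kb')
  obtain ⟨N₁, hN₁⟩ := eventually_atTop.1 (hlim.eventually_lt_const (by positivity : (0 : ℝ) < η / 4))
  refine ⟨max (max N₁ NK) (max NS NM), fun N hN Ψ hΨb => ?_⟩
  have hNN₁ : N₁ ≤ N := (le_max_left _ _).trans ((le_max_left _ _).trans hN)
  have hNNK : NK ≤ N := (le_max_right _ _).trans ((le_max_left _ _).trans hN)
  have hNNS : NS ≤ N := (le_max_left _ _).trans ((le_max_right _ _).trans hN)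
  have hNNM : NM ≤ N := (le_max_right _ _).trans ((le_max_right _ _).trans hN)
  have hε0 : 0 < hsDiameter σ N := hsDiameter_pos hσ N
  -- the constant of the quadratic majorant at this `N`
  obtain ⟨c, hc⟩ : ∃ c : ℝ, c = 2 * L * (Cg * ϵ₁ + Cχ * ϵ₂) + (κ * hsDiameter σ N) ^ 2 * D := ⟨_, rfl⟩
  have hc0 : 0 ≤ c := by rw [hc]; positivity
  have hcKb : c * Kb' ≤ η / 2 := by
    have h := (hN₁ N hNN₁).le
    calc c * Kb' = 2 * L * (Cg * ϵ₁ + Cχ * ϵ₂) * Kb' + (κ * hsDiameter σ N) ^ 2 * (D * Kb') := by rw [hc]; ring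
      _ ≤ η / 4 + η / 4 := add_le_add hblim h
      _ = η / 2 := by ring
  -- the four events
  set P := localGibbsLaw σ a₀ u₀ θ₀ N (Φ N) with hP
  have hK1 := hK N hNNK 0
  have hM1 := hM N hNNM
  simp only [] at hM1
  have hS1 := hNS N hNNS Ψ hΨb
  obtain ⟨EK, hEK⟩ : ∃ EK : Set (Config (N + 1) (Fin 3) T3),
      EK = {z | E₀ < ((N : ℝ) + 1)⁻¹ * configEnergy ((Φ N).flow 0 z)} := ⟨_, rfl⟩
  obtain ⟨EM, hEM⟩ : ∃ EM : Set (Config (N + 1) (Fin 3) T3), EM = {z | Kb < hsDiameter σ N / (N + 1 : ℝ) *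
    ∑ᶠ (s : ℝ) (_ : s ∈ collisionTimes (Torus.geometry (Fin 3)) (hsDiameter σ N) (fun s => (Φ N).flow s z) ∩
      Set.Icc 0 τ), ∑ i : Fin (N + 1), ∑ j : Fin (N + 1),
        (if i ≠ j ∧ ‖(Torus.geometry (Fin 3)).sepVec ((Φ N).flow s z i).1 ((Φ N).flow s z j).1‖ =
          hsDiameter σ N then 1 + ‖((Φ N).flow s z i).2‖ ^ 2 + ‖((Φ N).flow s z j).2‖ ^ 2 else 0)} :=
    ⟨_, rfl⟩
  obtain ⟨ES, hES⟩ : ∃ ES : Set (Config (N + 1) (Fin 3) T3),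
      ES = {z | η / (2 * C₂) < ((N + 1 : ℝ) * κ)⁻¹ * shortFlightDeficit σ N (Φ N) τ Ψ κ z} := ⟨_, rfl⟩
  have hPK : P EK ≤ ENNReal.ofReal (δ / 3) := by rw [hEK]; exact hK1
  have hPM : P EM ≤ ENNReal.ofReal (δ / 3) := by rw [hEM]; exact hM1
  have hPS : P ES ≤ ENNReal.ofReal (δ / 3) := by rw [hES]; exact hS1
  have hP0 : P (Φ N).goodᶜ = 0 := localGibbsLaw_goodCompl (Φ N)
  -- the inclusion of events
  have hsub : {z | η < ((N + 1 : ℝ) * κ)⁻¹ * continuityCorrection σ N (Φ N) τ χ g Ψ r κ z} ⊆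
      (((Φ N).goodᶜ ∪ EK) ∪ EM) ∪ ES := by
    intro z hz
    by_contra hnot
    simp only [mem_union, not_or] at hnot
    obtain ⟨⟨⟨hgood, hzK⟩, hzM⟩, hzS⟩ := hnot
    have hzg : z ∈ (Φ N).good := not_notMem.1 hgood
    rw [hEK] at hzK
    rw [hEM] at hzM
    rw [hES] at hzS
    simp only [mem_setOf_eq, not_lt] at hzK hzM hzS hz
    have hE' : ((N + 1 : ℕ) : ℝ)⁻¹ * configEnergy z ≤ E₀ := by
      rw [(Φ N).flow_zero z hzg] at hzK
      push_cast
      exact hzK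
    have hfin : (collisionTimes (Torus.geometry (Fin 3)) (hsDiameter σ N) (orbit σ N (Φ N) z) ∩ Icc 0 τ).Finite :=
      (isTraj hzg).locFinite 0 τ
    have hCPS : hsDiameter σ N / (N + 1 : ℝ) *
        collisionPairSum (Torus.geometry (Fin 3)) (hsDiameter σ N) (orbit σ N (Φ N) z) (Icc 0 τ)
          (fun s i j => 1 + ‖(orbit σ N (Φ N) z s i).2‖ ^ 2 + ‖(orbit σ N (Φ N) z s j).2‖ ^ 2) ≤ Kb' := by
      rw [collisionPairSum_eq_finsum_ite (orbit_mem hzg)]; exact hzM.trans hKbKb'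
    have hCC := continuityCorrection_le hzg hσ hr hκ hϵ₁0.le hϵ₂0.le hχb hgb hΨb hχuc hguc hE'
      (fun s t => stub_meanDisplacement (Φ N) hzg s t) (fun p : V3 × V3 => c * (1 + ‖p.1‖ ^ 2 + ‖p.2‖ ^ 2))
      (fun s i j => by
        show _ ≤ c * (1 + ‖(orbit σ N (Φ N) z s i).2‖ ^ 2 + ‖(orbit σ N (Φ N) z s j).2‖ ^ 2)
        rw [hc]
        exact hmark _ _ _)
    rw [collisionPairSum_const_mul hfin] at hCC
    obtain ⟨S, hSdef, hS0⟩ : ∃ S : ℝ, S = collisionPairSum (Torus.geometry (Fin 3)) (hsDiameter σ N)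
        (orbit σ N (Φ N) z) (Icc 0 τ)
          (fun s i j => 1 + ‖(orbit σ N (Φ N) z s i).2‖ ^ 2 + ‖(orbit σ N (Φ N) z s j).2‖ ^ 2) ∧ 0 ≤ S :=
      ⟨_, rfl, collisionPairSum_nonneg fun _ _ _ => by positivity⟩
    rw [← hSdef] at hCC hCPS
    obtain ⟨T, hTdef, hT0⟩ : ∃ T : ℝ, T = ((N + 1 : ℝ) * κ)⁻¹ * shortFlightDeficit σ N (Φ N) τ Ψ κ z ∧ 0 ≤ T :=
      ⟨_, rfl, mul_nonneg (by positivity)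
        (collisionPairSum_nonneg fun t i j => mul_nonneg (abs_nonneg _) (le_max_right _ _))⟩
    rw [← hTdef] at hzS
    have hκne : κ ≠ 0 := hκ.ne'
    have hN0 : (N + 1 : ℝ) ≠ 0 := by positivity
    have hX : ((N + 1 : ℝ) * κ)⁻¹ * continuityCorrection σ N (Φ N) τ χ g Ψ r κ z ≤
        c * (hsDiameter σ N / (N + 1 : ℝ) * S) + 2 * Cχ * Cg * T := by
      calc ((N + 1 : ℝ) * κ)⁻¹ * continuityCorrection σ N (Φ N) τ χ g Ψ r κ z
          ≤ ((N + 1 : ℝ) * κ)⁻¹ * (κ * hsDiameter σ N * (c * S) +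
              2 * Cχ * Cg * shortFlightDeficit σ N (Φ N) τ Ψ κ z) :=
            mul_le_mul_of_nonneg_left hCC (by positivity)
        _ = c * (hsDiameter σ N / (N + 1 : ℝ) * S) + 2 * Cχ * Cg * T := by
            rw [hTdef]
            field_simp
    have h1 : c * (hsDiameter σ N / (N + 1 : ℝ) * S) ≤ η / 2 := (mul_le_mul_of_nonneg_left hCPS hc0).trans hcKb
    have h2 : 2 * Cχ * Cg * T ≤ 2 * Cχ * Cg * (η / (2 * C₂)) := mul_le_mul_of_nonneg_left hzS (by positivity)
    have h3 : 2 * Cχ * Cg * (η / (2 * C₂)) ≤ C₂ * (η / (2 * C₂)) :=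
      mul_le_mul_of_nonneg_right (by rw [hC₂]; linarith) (by positivity)
    have h4 : C₂ * (η / (2 * C₂)) = η / 2 := by field_simp
    linarith
  -- assembly
  calc P {z | η < ((N + 1 : ℝ) * κ)⁻¹ * continuityCorrection σ N (Φ N) τ χ g Ψ r κ z}
      ≤ P ((((Φ N).goodᶜ ∪ EK) ∪ EM) ∪ ES) := measure_mono hsub
    _ ≤ P (((Φ N).goodᶜ ∪ EK) ∪ EM) + P ES := measure_union_le _ _
    _ ≤ (P ((Φ N).goodᶜ ∪ EK) + P EM) + P ES := add_le_add (measure_union_le _ _) le_rfl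
    _ ≤ ((P (Φ N).goodᶜ + P EK) + P EM) + P ES :=
        add_le_add (add_le_add (measure_union_le _ _) le_rfl) le_rfl
    _ ≤ ((0 + ENNReal.ofReal (δ / 3)) + ENNReal.ofReal (δ / 3)) + ENNReal.ofReal (δ / 3) :=
        add_le_add (add_le_add (add_le_add hP0.le hPK) hPM) hPS
    _ = ENNReal.ofReal δ := by
        rw [zero_add, ← ENNReal.ofReal_add (by positivity) (by positivity),
          ← ENNReal.ofReal_add (by positivity) (by positivity)]
        congr 1
        ring

end Summit.AtomisticToContinuum.HydrodynamicLimit.Theorems.CollisionRate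

end
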